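import Literature.MathematicalPhysics.QuantumFieldTheory.Federbush1986.AxialTreePureGauge
import Literature.MathematicalPhysics.QuantumFieldTheory.Federbush1986.ModeNonUniqueness

/-!
# `Federbush1986.LatticeAxialPotential` — [Federbush1986PhaseCellI] §1 p. 321 (axial paths), §4 (4.3)–(4.5) p. 329: THE
# LATTICE POINCARÉ LEMMA ON `ℤ⁴` (a curl-free bond function is the lattice gradient of its axial path sum) AND A SMOOTH
# GAUGE FUNCTION WITH PRESCRIBED UNIT-BOX AVERAGES — PROVED

statement-level skeleton of published theorems with citation tags; proofs where landed; nothing here is a claim about the Yang–Mills mass gap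

CITATION HEADER.  P. Federbush, *A phase cell approach to Yang–Mills theory. I*, Commun. Math. Phys. **107** (1986) 319–329
[Federbush1986PhaseCellI]: §1 pp. 321–322 verbatim *«We establish a maximal tree in each block. We let x be a point in one of the
blocks, x′ the corresponding point in the other block. Γ_x is a path between base points, along portions of the maximal trees and a
straight line segment joining x and x′»* — print leaves the maximal tree arbitrary (§2 p. 325 «the particular (arbitrary) choice of
maximal tree in each block»); the AXIAL trees (first along `e_0`, then `e_1`, `e_2`, `e_3`) are the tree's concrete admissible choice
`axialTreeAveraging` (`AxialTreeAveraging`), here used on the unit lattice from a corner `c` (v1.2 DOCFIX, r17 gen 13: the v1 header's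
«Γ_x is a path … moving sequentially parallel to the x_1, x_2, x_3, x_4 axes», marked verbatim, is on no page of [Federbush1986PhaseCellI] —
it described the tree's axial choice; found by the r17 g13 quotation audit against the OCR text `texts/fed1986-cmp107/p003–p004.txt`), (1.4) p. 322 (paths differing by
plaquettes), and §4 p. 329: (4.3) `A(e) − A^N(e) = h(b) − h(a)`, (4.5) `Λ(x) = h(x), x ∈ Z⁴`, with *«Mirabile dictu the bond
assignments to e at level 0, due to this A_μ(x), are exactly the A(e)»* — the tree's `AxialTreePureGauge.approxTop_pureGauge`
(level-0 bond variables of a pure gauge `dΛ` = lattice gradient of the unit-box averages of `Λ`).  Unit `lit-balaban-r17`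
gen 12; SKELETON rows F1.Eq4.1-4.6 and F1.Eq3.1 of `run/shared/lean/pub/lit-balaban/lit-balaban-r17/SKELETON-r17.md`.

THE MATHEMATICS.  (§1–§2) For a level-0 bond function `a : Edge 0 → ℝ` and a corner `c ∈ ℤ⁴`, the axial potential
`axialPot a c m` is the sum of `a` along the axial path from `c` to `m` (first along `e_0`, then `e_1`, `e_2`, `e_3`; vertices
`vtx c m k`).  If `a` is curl-free (`plaqOfBonds a q = 0` for every plaquette `q`) then on the orthant `c ≤ m`
`axialPot a c (m + e_μ) − axialPot a c m = a(m, μ)` (**`axialPot_gradient`**): the segments after the `μ`-th are translated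
by `e_μ`, and the difference of two parallel segment sums telescopes through the plaquettes between them
(`segSum_add_single_of_gt`).  `|axialPot| ≤ axialAbs` (the sum of `|a|` along the path).
(§3) With `β` the unit-mass smooth bump around the centre of the unit cube supported in the ball of radius `¼`
(`cellBump`, from `ModeNonUniqueness.gaugeBump`), `∫_{[0,1]⁴} β(n′ + u − n) du = δ_{nn′}` (**`setIntegral_cellBump_translate`**),
so the smooth function `λ_S g = Σ_{n∈S} g(n) β(· − n)` (`interp`) has unit-box averages `g` on `S` and `0` off `S`
(**`boxAvg_interp`**) and its pure gauge `dλ_S g` has level-0 bond variables the lattice gradient of `g|_S`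
(**`approxTop_pureGauge_interp`**, by `approxTop_pureGauge`).  (§4) At each point at most one translated bump is non-zero, whence
the pointwise bounds `|λ_S g(x)|, |dλ_S g(x)·v|/‖v‖ ≤ B·M` from `|g| ≤ M` (**`interp_bound`**).  USE (r17 gen 12, constrained
minimality of the Landau-gauge mode): subtracting `dλ` from a competitor with vanishing plaquette variables kills ALL its
level-0 bond variables on a box, so that only boundary bonds see the cut-off.

WHAT THIS MODULE PROVIDES.  Defs with bodies `vtx`, `segSum`, `axialPot`, `axialAbs`, `latVec`, `cellBump`, `interp`,
`restrict0`; the theorems above.  No `Prop` fact, no `sorry`; axioms standard.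
HONEST SCOPE vs PRINT (v1.1, r17 gen 13, on referee ref-1 gen 60's NOTE(F6); declarations untouched): the printed (4.5)–(4.6) prescribe
POINT VALUES `Λ(x) = h(x)`, `x ∈ Z⁴`, of a smooth `Λ` with the decay `|D^αΛ(x)| ≤ c_αe^{−γ|x|}` (4.6); this module's `interp` prescribes
UNIT-BOX AVERAGES of `λ_S g` on a FINITE set `S` of boxes (which is what the level-0 bond variables of `dλ` see, `approxTop_pureGauge`)
and proves only the pointwise bounds `interp_bound`, NO decay statement — the use made of it (cut-off competitors on a box in
`GaugeFixedCompetitor`/`ConstrainedMinimality`) needs neither point values nor decay.  (4.5)–(4.6) as printed are p04's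
`SmoothGaugeInterpolation` (row F1.Eq4.1-4.6).
-/

namespace Literature.MathematicalPhysics.QuantumFieldTheory.Federbush1986

open Filter Set MeasureTheory
open scoped Topology BigOperators

noncomputable section

namespace LatticePotential

/-! ## §1 The axial lattice path from a corner `c` to `m` and the path sum of a bond function -/

/-- The `k`-th vertex of the axial path from the corner `c` to `m`: coordinates `< k` already those of `m`, the others still
those of `c` (`vtx c m 0 = c`, `vtx c m 4 = m`). [cite: Federbush1986PhaseCellI, §1 p. 321 («Γ_x is a path … moving sequentially
parallel to the … axes», Fig. 2)] -/
def vtx (c m : Fin 4 → ℤ) (k : ℕ) : Fin 4 → ℤ := fun j => if (j : ℕ) < k then m j else c j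

/-- The start of the axial path is the corner. [cite: Federbush1986PhaseCellI, §1 p. 321] -/
theorem vtx_zero (c m : Fin 4 → ℤ) : vtx c m 0 = c := by
  funext j; simp [vtx]

/-- The end of the axial path is `m`. [cite: Federbush1986PhaseCellI, §1 p. 321] -/
theorem vtx_four (c m : Fin 4 → ℤ) : vtx c m 4 = m := by
  funext j; simp [vtx, j.isLt]

/-- One segment further: `vtx c m (k+1) = vtx c m k + (m_k − c_k) e_k`. [cite: Federbush1986PhaseCellI, §1 p. 321] -/
theorem vtx_succ (c m : Fin 4 → ℤ) (k : Fin 4) : vtx c m ((k : ℕ) + 1) = vtx c m k + Pi.single k (m k - c k) := by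
  funext j
  by_cases hj : j = k
  · subst hj; simp [vtx]
  · have hne : (j : ℕ) ≠ (k : ℕ) := fun h => hj (Fin.ext h)
    simp only [vtx, Pi.add_apply, Pi.single_eq_of_ne hj, add_zero]
    by_cases h1 : (j : ℕ) < k
    · simp [h1, show (j : ℕ) < (k : ℕ) + 1 by omega]
    · simp [h1, show ¬((j : ℕ) < (k : ℕ) + 1) by omega]

/-- Raising `m` in a direction `μ` not yet traversed (`k ≤ μ`) does not move the `k`-th vertex. [cite: Federbush1986PhaseCellI, §1 p. 321] -/
theorem vtx_add_single_of_le (c m : Fin 4 → ℤ) {k : ℕ} {μ : Fin 4} (h : k ≤ (μ : ℕ)) :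
    vtx c (m + Pi.single μ 1) k = vtx c m k := by
  funext j
  simp only [vtx, Pi.add_apply]
  by_cases hj : (j : ℕ) < k
  · have hjμ : j ≠ μ := fun e => by subst e; omega
    simp [hj, Pi.single_eq_of_ne hjμ]
  · simp [hj]

/-- Raising `m` in an already traversed direction (`μ < k`) translates the `k`-th vertex by `e_μ`. [cite: Federbush1986PhaseCellI, §1 p. 321] -/
theorem vtx_add_single_of_lt (c m : Fin 4 → ℤ) {k : ℕ} {μ : Fin 4} (h : (μ : ℕ) < k) :
    vtx c (m + Pi.single μ 1) k = vtx c m k + Pi.single μ 1 := by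
  funext j
  simp only [vtx, Pi.add_apply]
  by_cases hj : (j : ℕ) < k
  · simp [hj]
  · have hjμ : j ≠ μ := fun e => by subst e; omega
    simp [hj, Pi.single_eq_of_ne hjμ]

/-- The sum of a level-0 bond function along the `k`-th segment of the axial path `c → m` (for `c ≤ m`).
[cite: Federbush1986PhaseCellI, §1 p. 321, (1.10)–(1.11) p. 324] -/
def segSum (a : Edge 0 → ℝ) (c m : Fin 4 → ℤ) (k : Fin 4) : ℝ :=
  ∑ t ∈ Finset.range (m k - c k).toNat, a ⟨vtx c m k + Pi.single k (t : ℤ), k⟩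

/-- **The axial potential**: the sum of the bond function along the axial path from the corner `c` to `m` (the discrete line
integral; for a curl-free bond function its lattice gradient returns the bond function, `axialPot_gradient`).
[cite: Federbush1986PhaseCellI, §1 p. 321, (1.10)–(1.11) p. 324, (4.3)–(4.5) p. 329] -/
def axialPot (a : Edge 0 → ℝ) (c m : Fin 4 → ℤ) : ℝ := ∑ k : Fin 4, segSum a c m k

/-- The sum of the absolute values along the axial path (the trivial bound for the potential). [cite: Federbush1986PhaseCellI, §1 p. 321] -/
def axialAbs (a : Edge 0 → ℝ) (c m : Fin 4 → ℤ) : ℝ :=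
  ∑ k : Fin 4, ∑ t ∈ Finset.range (m k - c k).toNat, |a ⟨vtx c m k + Pi.single k (t : ℤ), k⟩|

/-- `|axialPot| ≤ axialAbs`. [cite: Federbush1986PhaseCellI, §1 p. 321] -/
theorem abs_axialPot_le (a : Edge 0 → ℝ) (c m : Fin 4 → ℤ) : |axialPot a c m| ≤ axialAbs a c m := by
  unfold axialPot axialAbs segSum
  refine (Finset.abs_sum_le_sum_abs _ _).trans (Finset.sum_le_sum fun k _ => Finset.abs_sum_le_sum_abs _ _)

/-! ## §2 The lattice Poincaré lemma: for a curl-free bond function the axial potential is a potential -/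

variable {a : Edge 0 → ℝ} {c m : Fin 4 → ℤ}

/-- Segments before the raised direction are unchanged. [cite: Federbush1986PhaseCellI, §1 p. 321] -/
theorem segSum_add_single_of_lt {k μ : Fin 4} (h : (k : ℕ) < μ) :
    segSum a c (m + Pi.single μ 1) k = segSum a c m k := by
  have hkμ : k ≠ μ := fun e => by subst e; omega
  unfold segSum
  rw [vtx_add_single_of_le c m h.le]
  simp [Pi.single_eq_of_ne hkμ]

/-- The segment in the raised direction gains one bond, the one at the vertex `vtx c m (μ+1)`. [cite: Federbush1986PhaseCellI, §1 p. 321] -/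
theorem segSum_add_single_self (μ : Fin 4) (hc : c μ ≤ m μ) :
    segSum a c (m + Pi.single μ 1) μ = segSum a c m μ + a ⟨vtx c m ((μ : ℕ) + 1), μ⟩ := by
  unfold segSum
  rw [vtx_add_single_of_le c m le_rfl]
  have hN : ((m + Pi.single μ 1 : Fin 4 → ℤ) μ - c μ).toNat = (m μ - c μ).toNat + 1 := by
    simp only [Pi.add_apply, Pi.single_eq_same]
    omega
  rw [hN, Finset.sum_range_succ, vtx_succ]
  congr 2
  have : ((m μ - c μ).toNat : ℤ) = m μ - c μ := Int.toNat_of_nonneg (by omega)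
  rw [this]

/-- **Curl-freeness moves a segment across a unit translation**: for `μ < k`, the `k`-th segment of the path to `m + e_μ` is the
`e_μ`-translate of that to `m`, and the difference of the two segment sums telescopes through the plaquettes between them to
`a(vtx_{k+1}, μ) − a(vtx_k, μ)`. [cite: Federbush1986PhaseCellI, §1 p. 321–322 (paths differing by plaquettes), (1.4) p. 322] -/
theorem segSum_add_single_of_gt {k μ : Fin 4} (h : (μ : ℕ) < k) (hck : c k ≤ m k) (hcurl : ∀ q : Plaq 0, plaqOfBonds a q = 0) :
    segSum a c (m + Pi.single μ 1) k = segSum a c m k + (a ⟨vtx c m ((k : ℕ) + 1), μ⟩ - a ⟨vtx c m k, μ⟩) := by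
  have hkμ : k ≠ μ := fun e => by subst e; omega
  unfold segSum
  rw [vtx_add_single_of_lt c m h]
  have hN : ((m + Pi.single μ 1 : Fin 4 → ℤ) k - c k).toNat = (m k - c k).toNat := by
    rw [Pi.add_apply, Pi.single_eq_of_ne hkμ, add_zero]
  rw [hN]
  set v := vtx c m k with hv
  -- the plaquette identity at the base `v + t e_k`, directions `(k, μ)`
  have hsq : ∀ t : ℕ, a ⟨v + Pi.single μ 1 + Pi.single k (t : ℤ), k⟩
      = a ⟨v + Pi.single k (t : ℤ), k⟩ + (a ⟨v + Pi.single k ((t + 1 : ℕ) : ℤ), μ⟩ - a ⟨v + Pi.single k (t : ℤ), μ⟩) := by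
    intro t
    have hq := hcurl ⟨v + Pi.single k (t : ℤ), k, μ⟩
    simp only [plaqOfBonds] at hq
    have e1 : v + Pi.single k (t : ℤ) + Pi.single k 1 = v + Pi.single k ((t + 1 : ℕ) : ℤ) := by
      rw [add_assoc, ← Pi.single_add]; push_cast; rfl
    have e2 : v + Pi.single k (t : ℤ) + Pi.single μ 1 = v + Pi.single μ 1 + Pi.single k (t : ℤ) := by abel
    rw [e1, e2] at hq
    linarith
  simp_rw [hsq]
  have htel := Finset.sum_range_sub (fun t : ℕ => a ⟨v + Pi.single k (t : ℤ), μ⟩) (m k - c k).toNat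
  rw [Finset.sum_add_distrib, htel]
  have hend : v + Pi.single k (((m k - c k).toNat : ℕ) : ℤ) = vtx c m ((k : ℕ) + 1) := by
    rw [hv, vtx_succ, Int.toNat_of_nonneg (by omega)]
  have hstart : v + Pi.single k ((0 : ℕ) : ℤ) = vtx c m k := by simp [hv]
  rw [hend, hstart]

/-- **THE LATTICE POINCARÉ LEMMA (axial gauge on `ℤ⁴`).**  If the level-0 bond function `a` is curl-free (every plaquette value
`plaqOfBonds a q` vanishes), then on the orthant `c ≤ m` the axial potential is a potential for it:
`axialPot a c (m + e_μ) − axialPot a c m = a(m, μ)` for every direction `μ`. [cite: Federbush1986PhaseCellI, §1 p. 321–322,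
(1.4) p. 322, (4.3)–(4.5) p. 329] -/
theorem axialPot_gradient (hcurl : ∀ q : Plaq 0, plaqOfBonds a q = 0) (hc : ∀ j, c j ≤ m j) (μ : Fin 4) :
    axialPot a c (m + Pi.single μ 1) - axialPot a c m = a ⟨m, μ⟩ := by
  have hm : vtx c m 4 = m := vtx_four c m
  -- the four directions, each an explicit telescoping sum over the later segments
  have L := fun (k : Fin 4) (h : (k : ℕ) < μ) => segSum_add_single_of_lt (a := a) (c := c) (m := m) h
  have E := segSum_add_single_self (a := a) (c := c) (m := m) μ (hc μ)
  have G := fun (k : Fin 4) (h : (μ : ℕ) < k) => segSum_add_single_of_gt (a := a) (c := c) (m := m) h (hc k) hcurl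
  unfold axialPot
  simp only [Fin.sum_univ_four]
  fin_cases μ
  · have e := E
    have g1 := G 1 (by decide); have g2 := G 2 (by decide); have g3 := G 3 (by decide)
    simp only [Fin.zero_eta, Fin.isValue, Fin.coe_ofNat_eq_mod, Nat.reduceMod, Nat.reduceAdd, hm] at e g1 g2 g3 ⊢
    linarith
  · have l0 := L 0 (by decide); have e := E
    have g2 := G 2 (by decide); have g3 := G 3 (by decide)
    simp only [Fin.mk_one, Fin.isValue, Fin.coe_ofNat_eq_mod, Nat.reduceMod, Nat.reduceAdd, hm] at l0 e g2 g3 ⊢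
    linarith
  · have l0 := L 0 (by decide); have l1 := L 1 (by decide); have e := E
    have g3 := G 3 (by decide)
    simp only [Fin.reduceFinMk, Fin.isValue, Fin.coe_ofNat_eq_mod, Nat.reduceMod, Nat.reduceAdd, hm]
      at l0 l1 e g3 ⊢
    linarith
  · have l0 := L 0 (by decide); have l1 := L 1 (by decide); have l2 := L 2 (by decide); have e := E
    simp only [Fin.reduceFinMk, Fin.isValue, Nat.reduceAdd, hm] at l0 l1 l2 e ⊢
    linarith

/-! ## §3 A smooth gauge function with prescribed lattice data: `λ_S g = Σ_{n ∈ S} g(n) β(· − n)` -/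

/-- The lattice point `n ∈ ℤ⁴ ⊂ ℝ⁴`. [cite: Federbush1986PhaseCellI, §1 p. 321] -/
def latVec (n : Fin 4 → ℤ) : E4 := mkPt fun k => (n k : ℝ)

/-- Coordinates of `latVec`. [cite: Federbush1986PhaseCellI, §1 p. 321] -/
@[simp] theorem latVec_apply (n : Fin 4 → ℤ) (k : Fin 4) : latVec n k = n k := rfl

/-- The level-0 base point of the edge `(n, μ)` is `n`. [cite: Federbush1986PhaseCellI, §1 p. 321] -/
theorem src_eq_latVec (n : Fin 4 → ℤ) (μ : Fin 4) : (⟨n, μ⟩ : Edge 0).src = latVec n := by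
  simp [Edge.src, latVec, latLen_zero]

/-- The unit-mass smooth bump `β` around the centre of the unit cube, supported in the ball of radius `¼` (so inside the open
cube): the normalisation of `ModeNonUniqueness.gaugeBump`. [cite: Federbush1986PhaseCellI, §0 p. 320 («[This does not
determine A_μ(x) uniquely.]»)] -/
def cellBump : E4 → ℝ := ModeNonUniqueness.gaugeBump.normed volume

/-- `β` is smooth. [cite: Federbush1986PhaseCellI, §0 p. 320] -/
theorem contDiff_cellBump {n : ℕ∞} : ContDiff ℝ n cellBump := ModeNonUniqueness.gaugeBump.contDiff_normed

/-- `β ≥ 0`. [cite: Federbush1986PhaseCellI, §0 p. 320] -/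
theorem cellBump_nonneg (x : E4) : 0 ≤ cellBump x := ModeNonUniqueness.gaugeBump.nonneg_normed x

/-- `∫ β = 1`. [cite: Federbush1986PhaseCellI, §0 p. 320] -/
theorem integral_cellBump : ∫ x, cellBump x = 1 := ModeNonUniqueness.gaugeBump.integral_normed

/-- The coordinates of the cube centre are `½`. [cite: Federbush1986PhaseCellI, §0 p. 320] -/
theorem cubeCentre_apply (k : Fin 4) : ModeNonUniqueness.cubeCentre k = 1 / 2 := by
  fin_cases k <;> simp [ModeNonUniqueness.cubeCentre, LatticeGauge.latPt, Edge.src, mkPt, unitVec]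

/-- Where `β ≠ 0` every coordinate is within `¼` of `½`. [cite: Federbush1986PhaseCellI, §0 p. 320] -/
theorem abs_sub_half_lt_of_cellBump_ne_zero {y : E4} (h : cellBump y ≠ 0) (k : Fin 4) : |y k - 1 / 2| < 1 / 4 := by
  have hy : y ∈ Function.support cellBump := h
  rw [cellBump, ContDiffBump.support_normed_eq, Metric.mem_ball, dist_eq_norm] at hy
  have h1 := PiLp.norm_apply_le (y - ModeNonUniqueness.cubeCentre : E4) k
  rw [PiLp.sub_apply, cubeCentre_apply, Real.norm_eq_abs] at h1
  exact h1.trans_lt (by simpa [ModeNonUniqueness.gaugeBump] using hy)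

/-- `β` vanishes at points with a coordinate at distance `≥ ¼` from `½`. [cite: Federbush1986PhaseCellI, §0 p. 320] -/
theorem cellBump_eq_zero_of_le {y : E4} {k : Fin 4} (h : 1 / 4 ≤ |y k - 1 / 2|) : cellBump y = 0 := by
  by_contra hne
  exact absurd (abs_sub_half_lt_of_cellBump_ne_zero hne k) (not_lt.mpr h)

/-- `mkPt` is additive. [folklore] -/
private theorem mkPt_add (u v : Fin 4 → ℝ) : (mkPt (u + v) : E4) = mkPt u + mkPt v := rfl

/-- Coordinates of `mkPt`. [folklore] -/
private theorem mkPt_apply (u : Fin 4 → ℝ) (k : Fin 4) : (mkPt u : E4) k = u k := rfl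

/-- **Orthonormality of the translated bumps against the unit boxes**: `∫_{[0,1]⁴} β(n′ + u − n) du = δ_{n n′}`.
[cite: Federbush1986PhaseCellI, (2.1)–(2.2) p. 325, §0 p. 320] -/
theorem setIntegral_cellBump_translate (n n' : Fin 4 → ℤ) :
    ∫ u in Icc (0 : Fin 4 → ℝ) 1, cellBump (latVec n' + mkPt u - latVec n) = if n = n' then 1 else 0 := by
  by_cases hnn : n = n'
  · subst hnn
    rw [if_pos rfl]
    have h1 : ∀ u : Fin 4 → ℝ, cellBump (latVec n + mkPt u - latVec n) = cellBump (mkPt u) := fun u => by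
      rw [add_sub_cancel_left]
    simp_rw [h1]
    rw [setIntegral_eq_integral_of_forall_compl_eq_zero fun u hu => ?_]
    · rw [← integral_cellBump,
        ← (PiLp.volume_preserving_toLp (Fin 4)).integral_comp (MeasurableEquiv.toLp 2 (Fin 4 → ℝ)).measurableEmbedding]
      rfl
    · -- outside the closed unit box some coordinate is `< 0` or `> 1`
      simp only [mem_Icc, Pi.le_def, Pi.zero_apply, Pi.one_apply, not_and_or, not_forall, not_le] at hu
      rcases hu with ⟨k, hk⟩ | ⟨k, hk⟩
      · exact cellBump_eq_zero_of_le (k := k) (by rw [mkPt_apply, abs_of_neg (by linarith)]; linarith)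
      · exact cellBump_eq_zero_of_le (k := k) (by rw [mkPt_apply, abs_of_pos (by linarith)]; linarith)
  · rw [if_neg hnn]
    refine setIntegral_eq_zero_of_forall_eq_zero fun u hu => ?_
    obtain ⟨k, hk⟩ : ∃ k, n k ≠ n' k := by
      by_contra hall; push Not at hall; exact hnn (funext hall)
    simp only [mem_Icc, Pi.le_def, Pi.zero_apply, Pi.one_apply] at hu
    refine cellBump_eq_zero_of_le (k := k) ?_
    have hcoord : (latVec n' + mkPt u - latVec n : E4) k = u k + ((n' k - n k : ℤ) : ℝ) := by
      simp only [PiLp.sub_apply, PiLp.add_apply, latVec_apply, mkPt_apply]; push_cast; ring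
    rw [hcoord]
    rcases lt_or_gt_of_ne hk with hlt | hgt
    · have : (1 : ℝ) ≤ ((n' k - n k : ℤ) : ℝ) := by exact_mod_cast (show (1 : ℤ) ≤ n' k - n k by omega)
      rw [abs_of_pos (by linarith [hu.1 k])]; linarith [hu.1 k]
    · have : ((n' k - n k : ℤ) : ℝ) ≤ -1 := by exact_mod_cast (show n' k - n k ≤ -1 by omega)
      rw [abs_of_neg (by linarith [hu.2 k])]; linarith [hu.2 k]

/-- **The smooth interpolant** `λ_S g(x) = Σ_{n ∈ S} g(n) β(x − n)` of the lattice function `g` on the finite set `S`: a smooth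
gauge function whose unit-box averages are `g` on `S` (`boxAvg_interp`), hence whose pure gauge `dλ` has level-0 bond variables
the lattice gradient of `g` (`approxTop_pureGauge_interp`). [cite: Federbush1986PhaseCellI, (3.2) p. 327, (4.3)–(4.5) p. 329,
(2.1)–(2.2) p. 325] -/
def interp (S : Finset (Fin 4 → ℤ)) (g : (Fin 4 → ℤ) → ℝ) (x : E4) : ℝ := ∑ n ∈ S, g n * cellBump (x - latVec n)

/-- `λ_S g` is smooth. [cite: Federbush1986PhaseCellI, (3.2) p. 327] -/
theorem contDiff_interp (S : Finset (Fin 4 → ℤ)) (g : (Fin 4 → ℤ) → ℝ) {k : ℕ∞} : ContDiff ℝ k (interp S g) := by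
  unfold interp
  exact ContDiff.sum fun n _ => contDiff_const.mul (contDiff_cellBump.comp (contDiff_id.sub contDiff_const))

/-- The restriction of `g` to `S` (extended by `0`). [cite: Federbush1986PhaseCellI, (4.3) p. 329] -/
def restrict0 (S : Finset (Fin 4 → ℤ)) (g : (Fin 4 → ℤ) → ℝ) (n : Fin 4 → ℤ) : ℝ := if n ∈ S then g n else 0

/-- **Box averages of the interpolant are the lattice data**: `M_0(λ_S g)(n′) = g(n′)` for `n′ ∈ S` (and `0` off `S`).
[cite: Federbush1986PhaseCellI, (2.1)–(2.2) p. 325, (4.5) p. 329] -/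
theorem boxAvg_interp (S : Finset (Fin 4 → ℤ)) (g : (Fin 4 → ℤ) → ℝ) (n' : Fin 4 → ℤ) (μ : Fin 4) :
    boxAvg 0 (interp S g) ((⟨n', μ⟩ : Edge 0).src) = restrict0 S g n' := by
  unfold boxAvg interp restrict0
  rw [src_eq_latVec, latLen_zero]
  simp only [one_smul]
  have hint : ∀ n ∈ S, IntegrableOn (fun u : Fin 4 → ℝ => g n * cellBump (latVec n' + mkPt u - latVec n))
      (Icc (0 : Fin 4 → ℝ) 1) := fun n _ =>
    (continuous_const.mul (contDiff_cellBump (n := 0)).continuous |>.comp' ?_).continuousOn.integrableOn_compact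
      isCompact_Icc
  · rw [integral_finsetSum _ hint]
    simp_rw [integral_const_mul, setIntegral_cellBump_translate, mul_ite, mul_one, mul_zero]
    rw [Finset.sum_ite_eq']
  · exact (continuous_const.add (PiLp.continuous_toLp 2 (fun _ : Fin 4 => ℝ))).sub continuous_const

/-- **The pure gauge `dλ_S g` has level-0 bond variables the lattice gradient of `g|_S`.** [cite: Federbush1986PhaseCellI,
(3.2) p. 327, (4.3)–(4.5) p. 329 («Mirabile dictu …»), (2.1)–(2.2) p. 325] -/
theorem approxTop_pureGauge_interp (S : Finset (Fin 4 → ℤ)) (g : (Fin 4 → ℤ) → ℝ) (b : Fin 4 → ℤ) (μ : Fin 4) :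
    approxTop 0 (pureGauge (interp S g)) ⟨b, μ⟩ = restrict0 S g (b + Pi.single μ 1) - restrict0 S g b := by
  rw [approxTop_pureGauge (contDiff_interp S g) 0 b μ, boxAvg_interp, boxAvg_interp]

/-! ## §4 Pointwise bounds for the interpolant and its differential -/

/-- At each point at most one translated bump is non-zero. [cite: Federbush1986PhaseCellI, §0 p. 320] -/
theorem eq_of_cellBump_ne_zero {x : E4} {n n' : Fin 4 → ℤ} (h : cellBump (x - latVec n) ≠ 0)
    (h' : cellBump (x - latVec n') ≠ 0) : n = n' := by
  funext k
  have h1 := abs_sub_half_lt_of_cellBump_ne_zero h k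
  have h2 := abs_sub_half_lt_of_cellBump_ne_zero h' k
  simp only [PiLp.sub_apply, latVec_apply] at h1 h2
  have h3 : |((n k : ℤ) : ℝ) - n' k| < 1 := by
    rw [abs_lt] at h1 h2 ⊢; constructor <;> linarith [h1.1, h1.2, h2.1, h2.2]
  have h4 : |n k - n' k| < 1 := by exact_mod_cast h3
  rw [abs_lt] at h4
  omega

/-- `β` and `dβ` vanish together: where `β = 0` (a minimum of `β ≥ 0`) the differential vanishes. [cite: Federbush1986PhaseCellI, §0 p. 320] -/
theorem fderiv_cellBump_eq_zero {y : E4} (h : cellBump y = 0) : fderiv ℝ cellBump y = 0 := by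
  refine IsLocalMin.fderiv_eq_zero ?_
  exact Filter.Eventually.of_forall fun z => by rw [h]; exact cellBump_nonneg z

/-- **A uniform bound for `β` and `dβ`.** [cite: Federbush1986PhaseCellI, §0 p. 320] -/
theorem exists_cellBump_bound : ∃ B : ℝ, 0 ≤ B ∧ (∀ y, |cellBump y| ≤ B) ∧ ∀ y, ‖fderiv ℝ cellBump y‖ ≤ B := by
  have hc : HasCompactSupport cellBump := ModeNonUniqueness.gaugeBump.hasCompactSupport_normed
  obtain ⟨B₁, hB₁⟩ := hc.exists_bound_of_continuous (contDiff_cellBump (n := 0)).continuous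
  obtain ⟨B₂, hB₂⟩ := (hc.fderiv ℝ).exists_bound_of_continuous ((contDiff_cellBump (n := 1)).continuous_fderiv one_ne_zero)
  refine ⟨max (max B₁ B₂) 0, le_max_right _ _, fun y => ?_, fun y => ?_⟩
  · have := hB₁ y; rw [Real.norm_eq_abs] at this
    exact this.trans ((le_max_left _ _).trans (le_max_left _ _))
  · exact (hB₂ y).trans ((le_max_right _ _).trans (le_max_left _ _))

/-- **Pointwise bound for the interpolant and its differential**: if `|g(n)| ≤ M` for the (at most one) `n ∈ S` whose bump is
non-zero at `x`, then `|λ_S g(x)| ≤ B·M` and `|dλ_S g(x)·v| ≤ B·M·‖v‖`, `B` the bound of `exists_cellBump_bound`.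
[cite: Federbush1986PhaseCellI, (3.2) p. 327, §0 p. 320] -/
theorem interp_bound {B : ℝ} (hB : (∀ y, |cellBump y| ≤ B) ∧ ∀ y, ‖fderiv ℝ cellBump y‖ ≤ B)
    (S : Finset (Fin 4 → ℤ)) (g : (Fin 4 → ℤ) → ℝ) {x : E4} {M : ℝ} (hM : 0 ≤ M)
    (h : ∀ n ∈ S, cellBump (x - latVec n) ≠ 0 → |g n| ≤ M) :
    |interp S g x| ≤ B * M ∧ ∀ v : E4, |fderiv ℝ (interp S g) x v| ≤ B * M * ‖v‖ := by
  have hB0 : 0 ≤ B := (abs_nonneg _).trans (hB.1 0)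
  -- the differential of the finite sum
  have hdiff : ∀ n : Fin 4 → ℤ, DifferentiableAt ℝ (fun x : E4 => g n * cellBump (x - latVec n)) x := fun n =>
    (((contDiff_cellBump (n := 1)).differentiable one_ne_zero) _ |>.comp x
      (differentiableAt_id.sub (differentiableAt_const _))).const_mul _
  have hfd : ∀ v : E4, fderiv ℝ (interp S g) x v = ∑ n ∈ S, g n * fderiv ℝ cellBump (x - latVec n) v := by
    intro v
    have h1 : interp S g = fun x => ∑ n ∈ S, g n * cellBump (x - latVec n) := rfl
    rw [h1, fderiv_fun_sum fun n _ => hdiff n, FunLike.coe_sum, Finset.sum_apply]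
    refine Finset.sum_congr rfl fun n _ => ?_
    have hc : DifferentiableAt ℝ (fun x : E4 => cellBump (x - latVec n)) x :=
      ((contDiff_cellBump (n := 1)).differentiable one_ne_zero _).comp x
        (differentiableAt_id.sub (differentiableAt_const _))
    rw [fderiv_const_mul hc, FunLike.coe_smul, Pi.smul_apply, smul_eq_mul, fderiv_comp_sub]
  by_cases hex : ∃ n₀ ∈ S, cellBump (x - latVec n₀) ≠ 0
  · obtain ⟨n₀, hn₀S, hn₀⟩ := hex
    have hothers : ∀ n ∈ S, n ≠ n₀ → cellBump (x - latVec n) = 0 := fun n _ hne => by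
      by_contra hne'; exact hne (eq_of_cellBump_ne_zero hne' hn₀)
    have hg := h n₀ hn₀S hn₀
    constructor
    · unfold interp
      rw [Finset.sum_eq_single_of_mem n₀ hn₀S fun n hn hne => by rw [hothers n hn hne, mul_zero], abs_mul]
      calc |g n₀| * |cellBump (x - latVec n₀)| ≤ M * B := mul_le_mul hg (hB.1 _) (abs_nonneg _) hM
        _ = B * M := mul_comm _ _
    · intro v
      rw [hfd v, Finset.sum_eq_single_of_mem n₀ hn₀S fun n hn hne => by
        rw [fderiv_cellBump_eq_zero (hothers n hn hne), zero_apply, mul_zero], abs_mul]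
      calc |g n₀| * |fderiv ℝ cellBump (x - latVec n₀) v| ≤ M * (B * ‖v‖) := by
            refine mul_le_mul hg ?_ (abs_nonneg _) hM
            rw [← Real.norm_eq_abs]
            exact (ContinuousLinearMap.le_opNorm _ _).trans (mul_le_mul_of_nonneg_right (hB.2 _) (norm_nonneg _))
        _ = B * M * ‖v‖ := by ring
  · push Not at hex
    constructor
    · unfold interp
      rw [Finset.sum_eq_zero fun n hn => by rw [hex n hn, mul_zero], abs_zero]; positivity
    · intro v
      rw [hfd v, Finset.sum_eq_zero fun n hn => by
        rw [fderiv_cellBump_eq_zero (hex n hn), zero_apply, mul_zero], abs_zero]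
      positivity

end LatticePotential

end

end Literature.MathematicalPhysics.QuantumFieldTheory.Federbush1986
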